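import Literature.NumberTheory.Transcendental.BakerQuantSetup
import Literature.NumberTheory.Transcendental.BakerQuantArith
import HarnessLib

/-!
# Baker 1975, Ch. 3 — the algebraic twin of `f(l)` (Lemma 4, eq. (4)–(5); Lemma 5, second part)

Support for the proof of Theorem 3.1 of A. Baker, *Transcendental Number Theory* (1975), Ch. 3
(`Literature.NumberTheory.Transcendental.baker1975_thm_3_1`); sequel to `BakerQuantSetup.lean`.

At a natural number `l`, the value `f_m(l) = F p m l` of the auxiliary function differs from the
ALGEBRAIC number
`P_m · ∑_u p(u) q(u, l) ∏ᵣ γᵣ^{mᵣ} ∏ᵢ αᵢ^{λᵢ l}` (`P_m = ∏ᵣ lᵣ^{mᵣ}`; Baker's left-hand side of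
(4), p. 32, "obtained from the number on the left of (3) … by substituting `αₙ` for `αₙ'`") only
through the factors `e^{λₙ Λ' l}` with `Λ'` the small linear form. This file provides:

* `Setup.αWit`, `Setup.aden`, `Setup.αM` — an integer polynomial vanishing at `αᵢ`, a
  denominator `aᵢ` (`aᵢ αᵢ` integral) and a bound `Mᵢ` for all conjugates of `αᵢ` (constants);
* `Data.gK u m l ∈ K` — the algebraic twin of one term (without `P_m`), `Data.Gtw p m l = ∑ p(u) gK`,
  and `gEval` — the same expression at arbitrary complex arguments (for the conjugates,
  `Data.map_gK`);
* `Data.term_nat_eq` — **`term(u, m, l) = gK · P_m · e^{λₙ Λ' l}`**, hence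
  `Data.norm_F_sub_le` — **(4) ⇒ (3)**: `|F p m l - P_m Gtw| ≤ |P_m| (∑|p(u)| |gK|) · 2 L l |Λ'|`
  (p. 33, via `|e^z - 1| ≤ 2|z|`);
* `Data.isIntegral_den_mul_gK` — `den · gK ∈ 𝓞_K` with the explicit denominator
  `den = ν(l;h)^k (∏ bⱼ)^k (∏ aᵢ)^{L l}` (`ν = nuBound l h` of `BakerQuantDelta`; Baker's
  `ν(l;2h)^{m₀} P'`, p. 34), and `Data.norm_map_gK_le` — the bound
  `k! 4^{(l+h)(L+1)} (1 + L eʰ)^k (2 L eʰ)^k M^{L l}` for all conjugates of `gK` (`|m| ≤ k`);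
* `Setup.norm_P_ge` — `|P_m| ≥ ℓ⁻^{-|m|}`.

Everything here is proved.

## References

* A. Baker, *Transcendental Number Theory*, Cambridge Univ. Press 1975, Ch. 3 §3, Lemma 4
  (eq. (4)–(5), pp. 32–33) and Lemma 5 (p. 34). [BakerTNT1975]
-/

noncomputable section

open Complex Finset Polynomial NumberField

namespace Literature.NumberTheory.Transcendental.Baker1975.Ch3

/-! ### Constants attached to the `αᵢ` -/

namespace Setup

variable (S : Setup)

/-- `αᵢ` is algebraic over `ℤ`. [folklore] -/
theorem isAlgebraic_int_α (i : Fin (S.n + 1)) : IsAlgebraic ℤ (S.α i) :=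
  (IsFractionRing.isAlgebraic_iff ℤ ℚ ℂ).mpr (S.isAlgebraic i)

/-- **An integer polynomial vanishing at `αᵢ`** (any one; e.g. the minimal polynomial of the
source, p. 27: "degrees at most `d` and heights at most `A`"). [cite: BakerTNT1975, Ch. 3 §1] -/
def αWit (i : Fin (S.n + 1)) : ℤ[X] := (S.isAlgebraic_int_α i).choose

/-- `αWit i ≠ 0` and `αWit i (αᵢ) = 0`. [folklore] -/
theorem αWit_spec (i : Fin (S.n + 1)) : S.αWit i ≠ 0 ∧ aeval (S.α i) (S.αWit i) = 0 :=
  (S.isAlgebraic_int_α i).choose_spec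

/-- The denominator `aᵢ = |leading coefficient of αWit i| ≥ 1` (`aᵢ αᵢ` is an algebraic integer;
Baker's "leading coefficients" `a₁, …, aₙ`, p. 20 and p. 36). [cite: BakerTNT1975, Ch. 3 §3 Lemma 7] -/
def aden (i : Fin (S.n + 1)) : ℕ := (S.αWit i).leadingCoeff.natAbs

/-- `1 ≤ aᵢ`. [folklore] -/
theorem one_le_aden (i : Fin (S.n + 1)) : 1 ≤ S.aden i :=
  Int.natAbs_pos.mpr (leadingCoeff_ne_zero.mpr (S.αWit_spec i).1)

/-- `aᵢ αᵢ` is an algebraic integer (in `ℂ`). [folklore] -/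
theorem isIntegral_aden_mul_α (i : Fin (S.n + 1)) : IsIntegral ℤ ((S.aden i : ℂ) * S.α i) := by
  have h1 : IsIntegral ℤ ((S.αWit i).leadingCoeff • S.α i) :=
    isIntegral_leadingCoeff_smul (S.αWit i) (S.α i) (S.αWit_spec i).2
  rw [zsmul_eq_mul] at h1
  have h2 : ((S.aden i : ℕ) : ℂ) = ((S.αWit i).leadingCoeff.sign : ℂ) * ((S.αWit i).leadingCoeff : ℂ) := by
    have h3 : ((S.aden i : ℕ) : ℤ) = (S.αWit i).leadingCoeff.sign * (S.αWit i).leadingCoeff := by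
      rw [aden]; exact (Int.sign_mul_self_eq_natAbs _).symm
    have h4 := congrArg (Int.cast (R := ℂ)) h3
    push_cast at h4
    exact h4
  rw [h2, mul_assoc]
  exact (isIntegral_algebraMap (R := ℤ) (A := ℂ) (x := (S.αWit i).leadingCoeff.sign)).mul h1

/-- The height bound `Hᵢ = ∑ |coefficients of αWit i|`. [folklore] -/
def αH (i : Fin (S.n + 1)) : ℝ := ∑ j ∈ (S.αWit i).support, |((S.αWit i).coeff j : ℝ)|

/-- Each coefficient of `αWit i` is at most `Hᵢ` in absolute value. [folklore] -/
theorem abs_coeff_αWit_le (i : Fin (S.n + 1)) (j : ℕ) : |((S.αWit i).coeff j : ℝ)| ≤ S.αH i := by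
  unfold αH
  by_cases hj : j ∈ (S.αWit i).support
  · exact single_le_sum (f := fun j => |((S.αWit i).coeff j : ℝ)|) (fun _ _ => abs_nonneg _) hj
  · rw [notMem_support_iff.mp hj]; simp only [Int.cast_zero, abs_zero]; positivity

/-- **The bound `Mᵢ = Hᵢ + 1 ≥ 1` for all conjugates of `αᵢ`** (Cauchy's bound applied to `αWit i`;
Baker, p. 34: "substituting arbitrary conjugates for the `α`'s"). [cite: BakerTNT1975, Ch. 3 §3 Lemma 5] -/
def αM (i : Fin (S.n + 1)) : ℝ := S.αH i + 1

/-- `1 ≤ Mᵢ`. [folklore] -/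
theorem one_le_αM (i : Fin (S.n + 1)) : 1 ≤ S.αM i := by
  have : 0 ≤ S.αH i := by unfold αH; positivity
  unfold αM; linarith

/-- Any complex root of `αWit i` — in particular any conjugate of `αᵢ` — is at most `Mᵢ`. [folklore] -/
theorem norm_le_αM_of_aeval {z : ℂ} (i : Fin (S.n + 1)) (hz : aeval z (S.αWit i) = 0) : ‖z‖ ≤ S.αM i :=
  norm_le_of_aeval_eq_zero (S.αWit_spec i).1 (S.abs_coeff_αWit_le i) hz

/-- `ℓ⁻ = 1 + ∑ᵣ |lᵣ|⁻¹`, so that `|lᵣ| ≥ 1/ℓ⁻` (a constant `c`). [cite: BakerTNT1975, Ch. 3 §3 Lemma 4] -/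
def ℓinv : ℝ := 1 + ∑ r : Fin S.n, ‖S.l (Fin.castSucc r)‖⁻¹

/-- `1 ≤ ℓ⁻`. [folklore] -/
theorem one_le_ℓinv : 1 ≤ S.ℓinv := by
  have : 0 ≤ ∑ r : Fin S.n, ‖S.l (Fin.castSucc r)‖⁻¹ := by positivity
  unfold ℓinv; linarith

/-- `P_m = ∏ᵣ lᵣ^{mᵣ}` (Baker's `P = (log α₁)^{m₁}⋯`, p. 33). [cite: BakerTNT1975, Ch. 3 §3 Lemma 4] -/
def P (m : Fin (S.n + 1) → ℕ) : ℂ := ∏ r : Fin S.n, S.l (Fin.castSucc r) ^ m r.succ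

/-- `P_m ≠ 0`. [folklore] -/
theorem P_ne_zero (m : Fin (S.n + 1) → ℕ) : S.P m ≠ 0 :=
  prod_ne_zero_iff.mpr fun _ _ => pow_ne_zero _ (S.l_ne_zero _)

/-- `|P_m| ≥ ℓ⁻^{-|m|}` (p. 33: "`|P| ≤ c₈ᵏ`" and its companion lower bound). [cite: BakerTNT1975, Ch. 3 §3 Lemma 4] -/
theorem norm_P_ge (m : Fin (S.n + 1) → ℕ) : (S.ℓinv ^ (∑ i, m i))⁻¹ ≤ ‖S.P m‖ := by
  have hℓ := S.one_le_ℓinv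
  have h1 : (S.ℓinv ^ (∑ i, m i))⁻¹ ≤ (S.ℓinv ^ (∑ r : Fin S.n, m r.succ))⁻¹ := by
    refine inv_anti₀ (by positivity) (pow_le_pow_right₀ hℓ ?_)
    rw [Fin.sum_univ_succ]; omega
  refine h1.trans ?_
  rw [P, norm_prod, ← inv_pow, ← prod_pow_eq_pow_sum]
  refine prod_le_prod (fun r _ => by positivity) fun r _ => ?_
  rw [norm_pow]
  refine pow_le_pow_left₀ (by positivity) ?_ _
  have h0 : 0 < ‖S.l (Fin.castSucc r)‖ := norm_pos_iff.mpr (S.l_ne_zero _)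
  rw [inv_le_comm₀ (by positivity) h0]
  have : ‖S.l (Fin.castSucc r)‖⁻¹ ≤ ∑ r' : Fin S.n, ‖S.l (Fin.castSucc r')‖⁻¹ :=
    single_le_sum (f := fun r' : Fin S.n => ‖S.l (Fin.castSucc r')‖⁻¹) (fun _ _ => by positivity)
      (mem_univ r)
  unfold ℓinv; linarith

/-- `|P_m| ≤ Λ^{|m|}`. [cite: BakerTNT1975, Ch. 3 §3 Lemma 4] -/
theorem norm_P_le (m : Fin (S.n + 1) → ℕ) : ‖S.P m‖ ≤ S.Λ ^ (∑ i, m i) := by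
  have hΛ := S.one_le_Λ
  rw [P, norm_prod]
  calc ∏ r : Fin S.n, ‖S.l (Fin.castSucc r) ^ m r.succ‖ ≤ ∏ r : Fin S.n, S.Λ ^ m r.succ := by
        refine prod_le_prod (fun r _ => norm_nonneg _) fun r _ => ?_
        rw [norm_pow]; exact pow_le_pow_left₀ (norm_nonneg _) (S.norm_l_le _) _
    _ = S.Λ ^ (∑ r : Fin S.n, m r.succ) := prod_pow_eq_pow_sum _ _ _
    _ ≤ S.Λ ^ (∑ i, m i) := pow_le_pow_right₀ hΛ (by rw [Fin.sum_univ_succ]; omega)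

end Setup

/-! ### The hasse values of `w_u` at natural numbers as rationals -/

namespace Data

variable {S : Setup} (D : Data S) {L : ℕ}

/-- The numerator `E = νᵘ · ((1/μ!) dᵘ w_u)(l) ∈ ℕ` (`ν = nuBound l h`; Lemma 1 of Ch. 3 via
`BakerQuantDelta.exists_nat_hasseDeriv_wPoly_eval`). [cite: BakerTNT1975, Ch. 3 §2 Lemma 1] -/
def hval (u : Idx S.n L D.h) (μ l : ℕ) : ℕ :=
  (exists_nat_hasseDeriv_wPoly_eval (b := (u.1.2 : ℕ)) (le_of_lt u.1.1.isLt) l μ).choose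

/-- The defining property of `hval`: `νᵘ · hasseDeriv μ w_u (l) = hval` and its size. [folklore] -/
theorem hval_spec (u : Idx S.n L D.h) (μ l : ℕ) :
    ((nuBound l D.h : ℂ)) ^ μ * (hasseDeriv μ (D.wOf u)).eval (l : ℂ) = (D.hval u μ l : ℂ) ∧
      D.hval u μ l ≤ 2 ^ ((u.1.1 : ℕ) + (u.1.2 : ℕ) * D.h) * nuBound l D.h ^ μ *
        ((l + (u.1.1 : ℕ)).choose (u.1.1 : ℕ) * (l + D.h).choose D.h ^ (u.1.2 : ℕ)) :=
  (exists_nat_hasseDeriv_wPoly_eval (b := (u.1.2 : ℕ)) (le_of_lt u.1.1.isLt) l μ).choose_spec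

/-- The hasse value as a complex number: `hasseDeriv μ w_u (l) = hval / νᵘ`. [folklore] -/
theorem hasseDeriv_wOf_eval_nat (u : Idx S.n L D.h) (μ l : ℕ) :
    (hasseDeriv μ (D.wOf u)).eval (l : ℂ) = (D.hval u μ l : ℂ) / (nuBound l D.h : ℂ) ^ μ := by
  have h := (D.hval_spec u μ l).1
  have hν : ((nuBound l D.h : ℕ) : ℂ) ^ μ ≠ 0 := pow_ne_zero _ (by exact_mod_cast (nuBound_pos l D.h).ne')
  rw [← h, mul_div_cancel_left₀ _ hν]

/-- The size of the hasse value: `|hval / νᵘ| ≤ 4^{(l+h)(L+1)}` (from the complex bound of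
`BakerQuantDelta.norm_hasseDeriv_wPoly_eval_le` at `z = l`). [cite: BakerTNT1975, Ch. 3 §2 Lemma 1] -/
theorem hval_div_le (u : Idx S.n L D.h) (μ l : ℕ) :
    (D.hval u μ l : ℝ) / (nuBound l D.h : ℝ) ^ μ ≤ (4 : ℝ) ^ ((l + D.h) * (L + 1)) := by
  have h1 := D.norm_hasseDeriv_wOf_le (L := L) u (l : ℂ) μ
  rw [D.hasseDeriv_wOf_eval_nat u μ l, norm_div, norm_pow, Complex.norm_natCast,
    Complex.norm_natCast] at h1
  have hl : ⌈‖(l : ℂ)‖⌉₊ = l := by rw [Complex.norm_natCast, Nat.ceil_natCast]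
  rwa [hl] at h1

/-! ### The generators inside `K` -/

/-- `αᵢ` as an element of `K`. [folklore] -/
def αK (i : Fin (S.n + 1)) : D.K := ⟨S.α i, D.αmem i⟩

/-- `(αK i : ℂ) = αᵢ`. [folklore] -/
@[simp] theorem coe_αK (i : Fin (S.n + 1)) : (D.αK i : ℂ) = S.α i := rfl

/-- `algebraMap K ℂ (αK i) = αᵢ`. [folklore] -/
@[simp] theorem algebraMap_αK (i : Fin (S.n + 1)) : algebraMap D.K ℂ (D.αK i) = S.α i := rfl

/-- `algebraMap K ℂ (βv j) = βv j`. [folklore] -/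
theorem algebraMap_βv (j : Option (Fin S.n)) : algebraMap D.K ℂ (D.βv j) = (D.βv j : ℂ) := rfl

/-- `αWit i` vanishes at `αK i` (in `K`). [folklore] -/
theorem aeval_αK (i : Fin (S.n + 1)) : aeval (D.αK i) (S.αWit i) = 0 := by
  have h : algebraMap D.K ℂ (aeval (D.αK i) (S.αWit i)) = 0 := by
    rw [← aeval_algebraMap_apply ℂ (D.αK i) (S.αWit i), algebraMap_αK]
    exact (S.αWit_spec i).2
  exact (map_eq_zero_iff _ (algebraMap D.K ℂ).injective).mp h

/-- **All conjugates of `αᵢ` are at most `Mᵢ`.** [cite: BakerTNT1975, Ch. 3 §3 Lemma 5] -/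
theorem norm_emb_αK_le (σ : D.K →+* ℂ) (i : Fin (S.n + 1)) : ‖σ (D.αK i)‖ ≤ S.αM i := by
  refine S.norm_le_αM_of_aeval i ?_
  have h := aeval_algHom_apply σ.toIntAlgHom (D.αK i) (S.αWit i)
  rw [RingHom.toIntAlgHom_apply, D.aeval_αK i, map_zero] at h
  exact h

/-- `aᵢ · αK i` is an algebraic integer of `K`. [folklore] -/
theorem isIntegral_aden_mul_αK (i : Fin (S.n + 1)) : IsIntegral ℤ ((S.aden i : D.K) * D.αK i) := by
  have h := S.isIntegral_aden_mul_α i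
  have e : algebraMap D.K ℂ ((S.aden i : D.K) * D.αK i) = (S.aden i : ℂ) * S.α i := by
    rw [map_mul, map_natCast, algebraMap_αK]
  rw [← e] at h
  exact (isIntegral_algHom_iff (IsScalarTower.toAlgHom ℤ D.K ℂ) (algebraMap D.K ℂ).injective).mp h

/-- Natural numbers are algebraic integers of `K`. [folklore] -/
theorem isIntegral_natCast_K (k : ℕ) : IsIntegral ℤ (k : D.K) := by
  exact_mod_cast isIntegral_algebraMap (R := ℤ) (A := D.K) (x := (k : ℤ))

/-- Integers are algebraic integers of `K`. [folklore] -/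
theorem isIntegral_intCast_K (k : ℤ) : IsIntegral ℤ (k : D.K) := by
  exact_mod_cast isIntegral_algebraMap (R := ℤ) (A := D.K) (x := k)

/-! ### The algebraic twin of a term -/

/-- The twin of one term at ARBITRARY complex arguments `a` (for the `αᵢ`), `b₀`, `b` (for the
`β`'s): `[∑_μ binom(m₀,μ) μ! (hval/νᵘ) (λₙ b₀)^{m₀-μ}] · ∏ᵣ (λᵣ + λₙ bᵣ)^{mᵣ} · ∏ᵢ aᵢ^{λᵢ l}`
(Baker's left-hand side of (4), p. 32, "with arbitrary conjugates substituted", p. 34).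
[cite: BakerTNT1975, Ch. 3 §3 Lemma 4, eq. (4)] -/
def gEval (a : Fin (S.n + 1) → ℂ) (b₀ : ℂ) (b : Fin S.n → ℂ) (u : Idx S.n L D.h)
    (m : Fin (S.n + 1) → ℕ) (l : ℕ) : ℂ :=
  (∑ μ ∈ range (m 0 + 1), ((m 0).choose μ : ℂ) * (μ.factorial : ℂ) *
      ((D.hval u μ l : ℂ) / (nuBound l D.h : ℂ) ^ μ) *
      (((u.2 (Fin.last S.n) : ℕ) : ℂ) * b₀) ^ (m 0 - μ)) *
    (∏ r : Fin S.n, ((((u.2 (Fin.castSucc r)) : ℕ) : ℂ) + ((u.2 (Fin.last S.n) : ℕ) : ℂ) * b r) ^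
      m r.succ) *
    ∏ i, a i ^ ((u.2 i : ℕ) * l)

/-- The Leibniz factor inside `K`: `∑_μ binom(m₀,μ) μ! (hval/νᵘ) (λₙ β₀)^{m₀-μ}`.
[cite: BakerTNT1975, Ch. 3 §3 Lemma 4] -/
def QwK (u : Idx S.n L D.h) (m₀ l : ℕ) : D.K :=
  ∑ μ ∈ range (m₀ + 1), ((m₀.choose μ : D.K) * (μ.factorial : D.K) *
    ((D.hval u μ l : D.K) / (nuBound l D.h : D.K) ^ μ) *
    (((u.2 (Fin.last S.n) : ℕ) : D.K) * D.βv none) ^ (m₀ - μ))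

/-- `γᵣ` inside `K`. [cite: BakerTNT1975, Ch. 3 §3 Lemma 4] -/
def γK (u : Idx S.n L D.h) (r : Fin S.n) : D.K :=
  ((u.2 (Fin.castSucc r) : ℕ) : D.K) + ((u.2 (Fin.last S.n) : ℕ) : D.K) * D.βv (some r)

/-- **The algebraic twin of one term** `gK = QwK · ∏ᵣ γᵣ^{mᵣ} · ∏ᵢ αᵢ^{λᵢ l} ∈ K`.
[cite: BakerTNT1975, Ch. 3 §3 Lemma 4, eq. (4)] -/
def gK (u : Idx S.n L D.h) (m : Fin (S.n + 1) → ℕ) (l : ℕ) : D.K :=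
  D.QwK u (m 0) l * (∏ r : Fin S.n, D.γK u r ^ m r.succ) * ∏ i, D.αK i ^ ((u.2 i : ℕ) * l)

/-- **The algebraic twin of `f_m(l)/P_m`**: `Gtw = ∑_u p(u) gK(u)`. [cite: BakerTNT1975, Ch. 3 §3 Lemma 4, eq. (4)] -/
def Gtw (p : Idx S.n L D.h → ℤ) (m : Fin (S.n + 1) → ℕ) (l : ℕ) : D.K := ∑ u, (p u : D.K) * D.gK u m l

/-- Conjugates of `gK` are `gEval` at the conjugates of the generators. [folklore] -/
theorem map_gK (σ : D.K →+* ℂ) (u : Idx S.n L D.h) (m : Fin (S.n + 1) → ℕ) (l : ℕ) :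
    σ (D.gK u m l) = D.gEval (fun i => σ (D.αK i)) (σ (D.βv none)) (fun r => σ (D.βv (some r))) u m l := by
  simp only [gK, QwK, γK, gEval, map_mul, map_prod, map_pow, map_sum, map_add, map_natCast,
    map_div₀]

/-- In `ℂ`, `gK` is `gEval` at the generators themselves. [folklore] -/
theorem algebraMap_gK (u : Idx S.n L D.h) (m : Fin (S.n + 1) → ℕ) (l : ℕ) :
    algebraMap D.K ℂ (D.gK u m l) = D.gEval S.α D.β₀ D.β u m l := by
  rw [D.map_gK]; rfl

/-- `e^{ψ_u l} = ∏ᵢ αᵢ^{λᵢ l}` for a natural number `l`. [folklore] -/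
theorem cexp_ψ_mul_nat (u : Idx S.n L D.h) (l : ℕ) :
    cexp (D.ψ u * (l : ℂ)) = ∏ i, S.α i ^ ((u.2 i : ℕ) * l) := by
  unfold ψ Setup.α
  rw [sum_mul, Complex.exp_sum]
  refine prod_congr rfl fun i _ => ?_
  rw [← Complex.exp_nat_mul]
  push_cast
  ring_nf

/-- The Leibniz factor at a natural number is the image of `QwK`. [folklore] -/
theorem Qw_nat_eq (u : Idx S.n L D.h) (m₀ l : ℕ) :
    Qw m₀ (D.wOf u) (D.bq u) (l : ℂ) = ∑ μ ∈ range (m₀ + 1), ((m₀.choose μ : ℂ) * (μ.factorial : ℂ) *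
      ((D.hval u μ l : ℂ) / (nuBound l D.h : ℂ) ^ μ) *
      (((u.2 (Fin.last S.n) : ℕ) : ℂ) * D.β₀) ^ (m₀ - μ)) := by
  unfold Qw
  refine sum_congr rfl fun μ _ => ?_
  rw [iterate_derivative_eval_eq_factorial_mul_hasseDeriv, D.hasseDeriv_wOf_eval_nat, bq]
  ring

/-- **`term = gK · P_m · e^{λₙ Λ' l}` at natural numbers** (Baker 1975, p. 33: the number on the
left of (3) is obtained from (4) by substituting `αₙ'` for `αₙ`, up to the factor `P`).
[cite: BakerTNT1975, Ch. 3 §3 Lemma 4] -/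
theorem term_nat_eq (u : Idx S.n L D.h) (m : Fin (S.n + 1) → ℕ) (l : ℕ) :
    D.term u m (l : ℂ) = D.gEval S.α D.β₀ D.β u m l * S.P m *
      cexp (((u.2 (Fin.last S.n) : ℕ) : ℂ) * D.Λ' * l) := by
  have hA : D.A u m = (∏ r : Fin S.n, D.γ u r ^ m r.succ) * S.P m := by
    unfold A Setup.P
    rw [← prod_mul_distrib]
    exact prod_congr rfl fun r _ => mul_pow _ _ _
  have hexp : cexp (D.expo u * l) = cexp (D.ψ u * (l : ℂ)) * cexp (((u.2 (Fin.last S.n) : ℕ) : ℂ) * D.Λ' * l) := by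
    rw [← Complex.exp_add, expo]; ring_nf
  rw [term, hA, hexp, D.cexp_ψ_mul_nat, D.Qw_nat_eq, gEval]
  simp only [γ]
  ring

/-- **`f_m(l)` and its twin**: `F p m l = P_m · ∑_u p(u) gK(u) e^{λₙ(u) Λ' l}`. [cite: BakerTNT1975, Ch. 3 §3 Lemma 4] -/
theorem F_nat_eq (p : Idx S.n L D.h → ℤ) (m : Fin (S.n + 1) → ℕ) (l : ℕ) :
    D.F p m (l : ℂ) = S.P m * ∑ u, (p u : ℂ) * algebraMap D.K ℂ (D.gK u m l) *
      cexp (((u.2 (Fin.last S.n) : ℕ) : ℂ) * D.Λ' * l) := by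
  unfold F
  rw [mul_sum]
  refine sum_congr rfl fun u _ => ?_
  rw [D.algebraMap_gK, D.term_nat_eq]
  ring

/-- The image of `Gtw` in `ℂ`. [folklore] -/
theorem algebraMap_G (p : Idx S.n L D.h → ℤ) (m : Fin (S.n + 1) → ℕ) (l : ℕ) :
    algebraMap D.K ℂ (D.Gtw p m l) = ∑ u, (p u : ℂ) * algebraMap D.K ℂ (D.gK u m l) := by
  unfold Gtw
  rw [map_sum]
  refine sum_congr rfl fun u _ => ?_
  rw [map_mul, map_intCast]

/-- **(4) ⇒ (3)** (Baker 1975, p. 33): `|F p m l - P_m · Gtw| ≤ |P_m| · (∑_u |p(u)| |gK(u)|) · 2 L l |Λ'|`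
provided `L l |Λ'| ≤ 1` (from `|e^z - 1| ≤ 2|z|` for `|z| ≤ 1`). [cite: BakerTNT1975, Ch. 3 §3 Lemma 4, eq. (5)] -/
theorem norm_F_sub_le (p : Idx S.n L D.h → ℤ) (m : Fin (S.n + 1) → ℕ) (l : ℕ)
    (hsmall : (L : ℝ) * l * ‖D.Λ'‖ ≤ 1) :
    ‖D.F p m (l : ℂ) - S.P m * algebraMap D.K ℂ (D.Gtw p m l)‖ ≤
      ‖S.P m‖ * (∑ u, |(p u : ℝ)| * ‖algebraMap D.K ℂ (D.gK u m l)‖) * (2 * L * l * ‖D.Λ'‖) := by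
  rw [D.F_nat_eq, D.algebraMap_G, ← mul_sub, ← sum_sub_distrib, norm_mul, mul_assoc]
  refine mul_le_mul_of_nonneg_left ?_ (norm_nonneg _)
  rw [sum_mul]
  refine (norm_sum_le _ _).trans (sum_le_sum fun u _ => ?_)
  have hz : ‖((u.2 (Fin.last S.n) : ℕ) : ℂ) * D.Λ' * l‖ ≤ L * l * ‖D.Λ'‖ := by
    rw [norm_mul, norm_mul, Complex.norm_natCast, Complex.norm_natCast]
    have h1 : ((u.2 (Fin.last S.n) : ℕ) : ℝ) ≤ L := by exact_mod_cast Nat.lt_succ_iff.mp (u.2 _).isLt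
    calc ((u.2 (Fin.last S.n) : ℕ) : ℝ) * ‖D.Λ'‖ * l ≤ L * ‖D.Λ'‖ * l := by gcongr
      _ = L * l * ‖D.Λ'‖ := by ring
  have hexp : ‖cexp (((u.2 (Fin.last S.n) : ℕ) : ℂ) * D.Λ' * l) - 1‖ ≤ 2 * (L * l * ‖D.Λ'‖) :=
    (Complex.norm_exp_sub_one_le (hz.trans hsmall)).trans (by linarith)
  calc ‖(p u : ℂ) * algebraMap D.K ℂ (D.gK u m l) * cexp (((u.2 (Fin.last S.n) : ℕ) : ℂ) * D.Λ' * l) -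
        (p u : ℂ) * algebraMap D.K ℂ (D.gK u m l)‖
      = ‖(p u : ℂ) * algebraMap D.K ℂ (D.gK u m l)‖ *
          ‖cexp (((u.2 (Fin.last S.n) : ℕ) : ℂ) * D.Λ' * l) - 1‖ := by
        rw [← norm_mul]; congr 1; ring
    _ ≤ (|(p u : ℝ)| * ‖algebraMap D.K ℂ (D.gK u m l)‖) * (2 * (L * l * ‖D.Λ'‖)) := by
        rw [norm_mul, Complex.norm_intCast]
        exact mul_le_mul_of_nonneg_left hexp (by positivity)
    _ = |(p u : ℝ)| * ‖algebraMap D.K ℂ (D.gK u m l)‖ * (2 * L * l * ‖D.Λ'‖) := by ring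

/-! ### Sizes of the conjugates of the twin -/

/-- **Size of `gEval`**: if `|aᵢ| ≤ Mᵢ` (`Mᵢ ≥ 1`), `|b₀|, |bᵣ| ≤ eʰ`, `m₀ ≤ k`, `∑ᵣ m_{r+1} ≤ k`,
`1 ≤ L`, then
`|gEval| ≤ k! 4^{(l+h)(L+1)} (1 + L eʰ)^k (2 L eʰ)^k (∏ Mᵢ)^{L l}` (Baker, p. 34: "each conjugate
of `Q` … has absolute value at most `c₁₈^{hk+Ll}`"). [cite: BakerTNT1975, Ch. 3 §3 Lemma 5] -/
theorem norm_gEval_le {a : Fin (S.n + 1) → ℂ} {b₀ : ℂ} {b : Fin S.n → ℂ} {M : Fin (S.n + 1) → ℝ}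
    (hM : ∀ i, 1 ≤ M i) (ha : ∀ i, ‖a i‖ ≤ M i) (hb₀ : ‖b₀‖ ≤ Real.exp D.h)
    (hb : ∀ r, ‖b r‖ ≤ Real.exp D.h) (u : Idx S.n L D.h) (m : Fin (S.n + 1) → ℕ) {k : ℕ}
    (hm0 : m 0 ≤ k) (hmr : ∑ r : Fin S.n, m r.succ ≤ k) (hL : 1 ≤ L) (l : ℕ) :
    ‖D.gEval a b₀ b u m l‖ ≤ k.factorial * (4 : ℝ) ^ ((l + D.h) * (L + 1)) *
      (1 + L * Real.exp D.h) ^ k * (2 * L * Real.exp D.h) ^ k * (∏ i, M i) ^ (L * l) := by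
  have hL0 : (0 : ℝ) ≤ L := Nat.cast_nonneg _
  have hL1 : (1 : ℝ) ≤ L := by exact_mod_cast hL
  have he := D.one_le_exp_h
  have hlam : ∀ i, ((u.2 i : ℕ) : ℝ) ≤ L := fun i => by exact_mod_cast Nat.lt_succ_iff.mp (u.2 i).isLt
  -- the Leibniz factor
  have hQ : ‖∑ μ ∈ range (m 0 + 1), ((m 0).choose μ : ℂ) * (μ.factorial : ℂ) *
      ((D.hval u μ l : ℂ) / (nuBound l D.h : ℂ) ^ μ) *
      (((u.2 (Fin.last S.n) : ℕ) : ℂ) * b₀) ^ (m 0 - μ)‖ ≤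
      k.factorial * (4 : ℝ) ^ ((l + D.h) * (L + 1)) * (1 + L * Real.exp D.h) ^ k := by
    have hb' : ‖((u.2 (Fin.last S.n) : ℕ) : ℂ) * b₀‖ ≤ L * Real.exp D.h := by
      rw [norm_mul, Complex.norm_natCast]
      exact mul_le_mul (hlam _) hb₀ (norm_nonneg _) hL0
    calc ‖∑ μ ∈ range (m 0 + 1), ((m 0).choose μ : ℂ) * (μ.factorial : ℂ) *
          ((D.hval u μ l : ℂ) / (nuBound l D.h : ℂ) ^ μ) * (((u.2 (Fin.last S.n) : ℕ) : ℂ) * b₀) ^ (m 0 - μ)‖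
        ≤ ∑ μ ∈ range (m 0 + 1), ‖((m 0).choose μ : ℂ) * (μ.factorial : ℂ) *
          ((D.hval u μ l : ℂ) / (nuBound l D.h : ℂ) ^ μ) * (((u.2 (Fin.last S.n) : ℕ) : ℂ) * b₀) ^ (m 0 - μ)‖ :=
          norm_sum_le _ _
      _ ≤ ∑ μ ∈ range (m 0 + 1), (k.factorial * (4 : ℝ) ^ ((l + D.h) * (L + 1))) *
          (((m 0).choose μ : ℝ) * (L * Real.exp D.h) ^ (m 0 - μ)) := by
          refine sum_le_sum fun μ hμ => ?_
          have hμm : μ ≤ m 0 := Nat.lt_succ_iff.mp (mem_range.mp hμ)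
          rw [norm_mul, norm_mul, norm_mul, norm_pow, Complex.norm_natCast, Complex.norm_natCast,
            norm_div, norm_pow, Complex.norm_natCast, Complex.norm_natCast]
          have h1 : (μ.factorial : ℝ) ≤ k.factorial := by
            exact_mod_cast Nat.factorial_le (hμm.trans hm0)
          have h2 := D.hval_div_le (L := L) u μ l
          have h3 : ‖((u.2 (Fin.last S.n) : ℕ) : ℂ) * b₀‖ ^ (m 0 - μ) ≤ (L * Real.exp D.h) ^ (m 0 - μ) :=
            pow_le_pow_left₀ (norm_nonneg _) hb' _
          calc ((m 0).choose μ : ℝ) * (μ.factorial : ℝ) * ((D.hval u μ l : ℝ) / (nuBound l D.h : ℝ) ^ μ) *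
                ‖((u.2 (Fin.last S.n) : ℕ) : ℂ) * b₀‖ ^ (m 0 - μ)
              ≤ ((m 0).choose μ : ℝ) * k.factorial * (4 : ℝ) ^ ((l + D.h) * (L + 1)) *
                (L * Real.exp D.h) ^ (m 0 - μ) := by gcongr
            _ = (k.factorial * (4 : ℝ) ^ ((l + D.h) * (L + 1))) *
                (((m 0).choose μ : ℝ) * (L * Real.exp D.h) ^ (m 0 - μ)) := by ring
      _ = (k.factorial * (4 : ℝ) ^ ((l + D.h) * (L + 1))) * (1 + L * Real.exp D.h) ^ (m 0) := by
          rw [← mul_sum, add_pow]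
          congr 1
          refine sum_congr rfl fun μ _ => ?_
          rw [one_pow, one_mul, mul_comm]
      _ ≤ k.factorial * (4 : ℝ) ^ ((l + D.h) * (L + 1)) * (1 + L * Real.exp D.h) ^ k := by
          refine mul_le_mul_of_nonneg_left (pow_le_pow_right₀ ?_ hm0) (by positivity)
          nlinarith
  -- the `γ` factor
  have hγ : ‖∏ r : Fin S.n, ((((u.2 (Fin.castSucc r)) : ℕ) : ℂ) + ((u.2 (Fin.last S.n) : ℕ) : ℂ) * b r) ^
      m r.succ‖ ≤ (2 * L * Real.exp D.h) ^ k := by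
    rw [norm_prod]
    calc ∏ r : Fin S.n, ‖((((u.2 (Fin.castSucc r)) : ℕ) : ℂ) + ((u.2 (Fin.last S.n) : ℕ) : ℂ) * b r) ^ m r.succ‖
        ≤ ∏ r : Fin S.n, (2 * L * Real.exp D.h) ^ m r.succ := by
          refine prod_le_prod (fun r _ => norm_nonneg _) fun r _ => ?_
          rw [norm_pow]
          refine pow_le_pow_left₀ (norm_nonneg _) ((norm_add_le _ _).trans ?_) _
          rw [norm_mul, Complex.norm_natCast, Complex.norm_natCast]
          have : ((u.2 (Fin.last S.n) : ℕ) : ℝ) * ‖b r‖ ≤ L * Real.exp D.h :=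
            mul_le_mul (hlam _) (hb r) (norm_nonneg _) hL0
          nlinarith [hlam (Fin.castSucc r)]
      _ = (2 * L * Real.exp D.h) ^ (∑ r : Fin S.n, m r.succ) := prod_pow_eq_pow_sum _ _ _
      _ ≤ (2 * L * Real.exp D.h) ^ k := pow_le_pow_right₀ (by nlinarith) hmr
  -- the `α` factor
  have hM1 : (1 : ℝ) ≤ ∏ i, M i := by
    calc (1 : ℝ) = ∏ _i : Fin (S.n + 1), (1 : ℝ) := by simp
      _ ≤ ∏ i, M i := prod_le_prod (fun _ _ => zero_le_one) fun i _ => hM i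
  have hα : ‖∏ i, a i ^ ((u.2 i : ℕ) * l)‖ ≤ (∏ i, M i) ^ (L * l) := by
    rw [norm_prod, ← prod_pow]
    refine prod_le_prod (fun i _ => norm_nonneg _) fun i _ => ?_
    rw [norm_pow]
    calc ‖a i‖ ^ ((u.2 i : ℕ) * l) ≤ M i ^ ((u.2 i : ℕ) * l) := pow_le_pow_left₀ (norm_nonneg _) (ha i) _
      _ ≤ M i ^ (L * l) := pow_le_pow_right₀ (hM i) (Nat.mul_le_mul_right _ (Nat.lt_succ_iff.mp (u.2 i).isLt))
  calc ‖D.gEval a b₀ b u m l‖ = ‖∑ μ ∈ range (m 0 + 1), ((m 0).choose μ : ℂ) * (μ.factorial : ℂ) *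
        ((D.hval u μ l : ℂ) / (nuBound l D.h : ℂ) ^ μ) * (((u.2 (Fin.last S.n) : ℕ) : ℂ) * b₀) ^ (m 0 - μ)‖ *
        ‖∏ r : Fin S.n, ((((u.2 (Fin.castSucc r)) : ℕ) : ℂ) + ((u.2 (Fin.last S.n) : ℕ) : ℂ) * b r) ^ m r.succ‖ *
        ‖∏ i, a i ^ ((u.2 i : ℕ) * l)‖ := by rw [gEval, norm_mul, norm_mul]
    _ ≤ (k.factorial * (4 : ℝ) ^ ((l + D.h) * (L + 1)) * (1 + L * Real.exp D.h) ^ k) *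
        (2 * L * Real.exp D.h) ^ k * (∏ i, M i) ^ (L * l) := by gcongr
    _ = _ := by ring

/-- **All conjugates of `gK` are bounded** by `k! 4^{(l+h)(L+1)} (1 + L eʰ)^k (2 L eʰ)^k (∏ Mᵢ)^{L l}`
(`m₀ ≤ k`, `∑ m_{r+1} ≤ k`, `1 ≤ L`). [cite: BakerTNT1975, Ch. 3 §3 Lemma 5] -/
theorem norm_map_gK_le (σ : D.K →+* ℂ) (u : Idx S.n L D.h) (m : Fin (S.n + 1) → ℕ) {k : ℕ}
    (hm0 : m 0 ≤ k) (hmr : ∑ r : Fin S.n, m r.succ ≤ k) (hL : 1 ≤ L) (l : ℕ) :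
    ‖σ (D.gK u m l)‖ ≤ k.factorial * (4 : ℝ) ^ ((l + D.h) * (L + 1)) *
      (1 + L * Real.exp D.h) ^ k * (2 * L * Real.exp D.h) ^ k * (∏ i, S.αM i) ^ (L * l) := by
  rw [D.map_gK]
  exact D.norm_gEval_le S.one_le_αM (D.norm_emb_αK_le σ) (D.norm_emb_le σ none)
    (fun r => D.norm_emb_le σ (some r)) u m hm0 hmr hL l

/-! ### Denominators of the twin -/

/-- **The explicit denominator** `den = ν(l;h)^k (∏ⱼ bⱼ)^k (∏ᵢ aᵢ)^{L l}` of `gK(u, m, l)` for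
`m₀ ≤ k`, `m_{r+1} ≤ k` (Baker's `(ν(l;2h))^{m₀} P'`, p. 34). [cite: BakerTNT1975, Ch. 3 §3 Lemma 5] -/
def den (L k l : ℕ) : ℕ := nuBound l D.h ^ k * (∏ j, D.bden j) ^ k * (∏ i, S.aden i) ^ (L * l)

/-- `den ≥ 1`. [folklore] -/
theorem one_le_den (L k l : ℕ) : 1 ≤ D.den L k l := by
  unfold den
  refine Nat.mul_pos (Nat.mul_pos (pow_pos (nuBound_pos l D.h) _) (pow_pos ?_ _)) (pow_pos ?_ _)
  · exact prod_pos fun j _ => D.one_le_bden j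
  · exact prod_pos fun i _ => S.one_le_aden i

/-- **Clearing the denominators of the Leibniz factor, termwise**: for `μ ≤ m₀ ≤ k`,
`ν^k b₀^k · [binom(m₀,μ) μ! (hval/νᵘ) (λₙβ₀)^{m₀-μ}]
 = binom(m₀,μ) μ! hval ν^{k-μ} λₙ^{m₀-μ} b₀^{k-(m₀-μ)} (b₀β₀)^{m₀-μ}`. [cite: BakerTNT1975, Ch. 3 §2 Lemma 1] -/
theorem mul_QwK_summand_eq (u : Idx S.n L D.h) {m₀ k μ : ℕ} (hμm : μ ≤ m₀) (hm0 : m₀ ≤ k) (l : ℕ) :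
    (nuBound l D.h : D.K) ^ k * (D.bden none : D.K) ^ k *
      ((m₀.choose μ : D.K) * (μ.factorial : D.K) * ((D.hval u μ l : D.K) / (nuBound l D.h : D.K) ^ μ) *
        (((u.2 (Fin.last S.n) : ℕ) : D.K) * D.βv none) ^ (m₀ - μ)) =
      (m₀.choose μ : D.K) * (μ.factorial : D.K) * (D.hval u μ l : D.K) *
        (nuBound l D.h : D.K) ^ (k - μ) * ((u.2 (Fin.last S.n) : ℕ) : D.K) ^ (m₀ - μ) *
        (D.bden none : D.K) ^ (k - (m₀ - μ)) * ((D.bden none : D.K) * D.βv none) ^ (m₀ - μ) := by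
  have hν : (nuBound l D.h : D.K) ≠ 0 := by exact_mod_cast (nuBound_pos l D.h).ne'
  have hνμ : (nuBound l D.h : D.K) ^ μ ≠ 0 := pow_ne_zero _ hν
  have key : (nuBound l D.h : D.K) ^ μ * ((D.hval u μ l : D.K) / (nuBound l D.h : D.K) ^ μ) =
      (D.hval u μ l : D.K) := by
    rw [mul_div_assoc', mul_div_cancel_left₀ _ hνμ]
  rw [mul_pow, ← pow_sub_mul_pow (nuBound l D.h : D.K) (hμm.trans hm0),
    ← pow_sub_mul_pow (D.bden none : D.K) (show m₀ - μ ≤ k by omega)]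
  calc (nuBound l D.h : D.K) ^ (k - μ) * (nuBound l D.h : D.K) ^ μ *
        ((D.bden none : D.K) ^ (k - (m₀ - μ)) * (D.bden none : D.K) ^ (m₀ - μ)) *
        ((m₀.choose μ : D.K) * (μ.factorial : D.K) * ((D.hval u μ l : D.K) / (nuBound l D.h : D.K) ^ μ) *
          (((u.2 (Fin.last S.n) : ℕ) : D.K) ^ (m₀ - μ) * D.βv none ^ (m₀ - μ)))
      = ((nuBound l D.h : D.K) ^ μ * ((D.hval u μ l : D.K) / (nuBound l D.h : D.K) ^ μ)) *
          ((m₀.choose μ : D.K) * (μ.factorial : D.K) * (nuBound l D.h : D.K) ^ (k - μ) *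
          ((u.2 (Fin.last S.n) : ℕ) : D.K) ^ (m₀ - μ) * (D.bden none : D.K) ^ (k - (m₀ - μ)) *
          ((D.bden none : D.K) ^ (m₀ - μ) * D.βv none ^ (m₀ - μ))) := by ring
    _ = _ := by rw [key, mul_pow]; ring

/-- **Clearing the denominators of the Leibniz factor**:
`ν^k b₀^k QwK = ∑_μ binom(m₀,μ) μ! hval ν^{k-μ} λₙ^{m₀-μ} b₀^{k-(m₀-μ)} (b₀β₀)^{m₀-μ}` (`m₀ ≤ k`).
[cite: BakerTNT1975, Ch. 3 §2 Lemma 1] -/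
theorem mul_QwK_eq (u : Idx S.n L D.h) {m₀ k : ℕ} (hm0 : m₀ ≤ k) (l : ℕ) :
    (nuBound l D.h : D.K) ^ k * (D.bden none : D.K) ^ k * D.QwK u m₀ l =
      ∑ μ ∈ range (m₀ + 1), (m₀.choose μ : D.K) * (μ.factorial : D.K) * (D.hval u μ l : D.K) *
        (nuBound l D.h : D.K) ^ (k - μ) * ((u.2 (Fin.last S.n) : ℕ) : D.K) ^ (m₀ - μ) *
        (D.bden none : D.K) ^ (k - (m₀ - μ)) * ((D.bden none : D.K) * D.βv none) ^ (m₀ - μ) := by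
  unfold QwK
  rw [mul_sum]
  refine sum_congr rfl fun μ hμ => ?_
  exact D.mul_QwK_summand_eq u (Nat.lt_succ_iff.mp (mem_range.mp hμ)) hm0 l

/-- `ν^k · bnone^k · QwK` is an algebraic integer (`k ≥ m₀`). [cite: BakerTNT1975, Ch. 3 §2 Lemma 1] -/
theorem isIntegral_mul_QwK (u : Idx S.n L D.h) {m₀ k : ℕ} (hm0 : m₀ ≤ k) (l : ℕ) :
    IsIntegral ℤ ((nuBound l D.h : D.K) ^ k * (D.bden none : D.K) ^ k * D.QwK u m₀ l) := by
  rw [D.mul_QwK_eq u hm0 l]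
  refine IsIntegral.sum _ fun μ _ => ?_
  refine IsIntegral.mul ?_ ((D.isIntegral_bden none).pow _)
  refine IsIntegral.mul ?_ ((D.isIntegral_natCast_K _).pow _)
  refine IsIntegral.mul ?_ ((D.isIntegral_natCast_K _).pow _)
  refine IsIntegral.mul ?_ ((D.isIntegral_natCast_K _).pow _)
  exact ((D.isIntegral_natCast_K _).mul (D.isIntegral_natCast_K _)).mul (D.isIntegral_natCast_K _)

/-- **`den · gK` factored over the generators**:
`den · gK = [ν^k b₀^k QwK] · ∏ᵣ [bᵣ^k γᵣ^{mᵣ}] · ∏ᵢ [aᵢ^{Ll} αᵢ^{λᵢ l}]`. [cite: BakerTNT1975, Ch. 3 §3 Lemma 5] -/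
theorem den_mul_gK_eq (u : Idx S.n L D.h) (m : Fin (S.n + 1) → ℕ) (k l : ℕ) :
    (D.den L k l : D.K) * D.gK u m l =
      ((nuBound l D.h : D.K) ^ k * (D.bden none : D.K) ^ k * D.QwK u (m 0) l) *
      (∏ r : Fin S.n, (D.bden (some r) : D.K) ^ k * D.γK u r ^ m r.succ) *
      ∏ i, (S.aden i : D.K) ^ (L * l) * D.αK i ^ ((u.2 i : ℕ) * l) := by
  rw [den, gK]
  push_cast
  rw [Fintype.prod_option, mul_pow, prod_mul_distrib, prod_mul_distrib]
  simp only [prod_pow]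
  ring

/-- **Clearing denominators**: `den · gK` is an algebraic integer when `m₀ ≤ k` and all
`m_{r+1} ≤ k` (Baker, p. 34: "on multiplying `Q` by `(ν(l;2h))^{m₀} P'` … one obtains an algebraic
integer"). [cite: BakerTNT1975, Ch. 3 §3 Lemma 5] -/
theorem isIntegral_den_mul_gK (u : Idx S.n L D.h) (m : Fin (S.n + 1) → ℕ) {k : ℕ}
    (hm0 : m 0 ≤ k) (hmr : ∀ r : Fin S.n, m r.succ ≤ k) (l : ℕ) :
    IsIntegral ℤ ((D.den L k l : D.K) * D.gK u m l) := by
  -- the three factors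
  have h1 := D.isIntegral_mul_QwK u hm0 l
  have h2 : ∀ r : Fin S.n, IsIntegral ℤ ((D.bden (some r) : D.K) ^ k * D.γK u r ^ m r.succ) := by
    intro r
    rw [← pow_sub_mul_pow (D.bden (some r) : D.K) (hmr r), mul_assoc, ← mul_pow, γK, mul_add,
      mul_left_comm]
    exact ((D.isIntegral_natCast_K _).pow _).mul ((((D.isIntegral_natCast_K _).mul
      (D.isIntegral_natCast_K _)).add ((D.isIntegral_natCast_K _).mul (D.isIntegral_bden (some r)))).pow _)
  have h3 : ∀ i, IsIntegral ℤ ((S.aden i : D.K) ^ (L * l) * D.αK i ^ ((u.2 i : ℕ) * l)) := by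
    intro i
    have hv : (u.2 i : ℕ) * l ≤ L * l := Nat.mul_le_mul_right _ (Nat.lt_succ_iff.mp (u.2 i).isLt)
    rw [← pow_sub_mul_pow (S.aden i : D.K) hv, mul_assoc, ← mul_pow]
    exact ((D.isIntegral_natCast_K _).pow _).mul ((D.isIntegral_aden_mul_αK i).pow _)
  rw [D.den_mul_gK_eq]
  exact (h1.mul (IsIntegral.prod _ fun r _ => h2 r)).mul (IsIntegral.prod _ fun i _ => h3 i)

/-- `den · Gtw` is an algebraic integer (for `|m| ≤ k`). [cite: BakerTNT1975, Ch. 3 §3 Lemma 5] -/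
theorem isIntegral_den_mul_G (p : Idx S.n L D.h → ℤ) (m : Fin (S.n + 1) → ℕ) {k : ℕ}
    (hm : ∑ i, m i ≤ k) (l : ℕ) : IsIntegral ℤ ((D.den L k l : D.K) * D.Gtw p m l) := by
  have hsum : (∑ i, m i) = m 0 + ∑ r : Fin S.n, m r.succ := Fin.sum_univ_succ m
  have hm0 : m 0 ≤ k := by omega
  have hmr : ∀ r : Fin S.n, m r.succ ≤ k := fun r => by
    have : m r.succ ≤ ∑ r' : Fin S.n, m r'.succ :=
      single_le_sum (f := fun r' : Fin S.n => m r'.succ) (fun _ _ => Nat.zero_le _) (mem_univ r)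
    omega
  unfold Gtw
  rw [mul_sum]
  refine IsIntegral.sum _ fun u _ => ?_
  rw [mul_left_comm]
  exact (D.isIntegral_intCast_K _).mul (D.isIntegral_den_mul_gK u m hm0 hmr l)

/-- **The size of the denominator**: `den ≤ ν^k · e^{h (n+1) k} · (∏ aᵢ)^{L l}`. [cite: BakerTNT1975, Ch. 3 §3 Lemma 5] -/
theorem den_le (L k l : ℕ) : (D.den L k l : ℝ) ≤
    (nuBound l D.h : ℝ) ^ k * Real.exp (D.h * ((S.n + 1) * k)) * ((∏ i, S.aden i : ℕ) : ℝ) ^ (L * l) := by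
  unfold den
  push_cast
  refine mul_le_mul_of_nonneg_right (mul_le_mul_of_nonneg_left ?_ (by positivity)) (by positivity)
  calc (∏ j, (D.bden j : ℝ)) ^ k ≤ (∏ _j : Option (Fin S.n), Real.exp D.h) ^ k := by
        refine pow_le_pow_left₀ (by positivity) (prod_le_prod (fun j _ => by positivity) fun j _ => D.bden_le j) _
    _ = Real.exp (D.h * ((S.n + 1) * k)) := by
        rw [prod_const, card_univ, Fintype.card_option, Fintype.card_fin, ← Real.exp_nat_mul,
          ← Real.exp_nat_mul]
        congr 1; push_cast; ring

end Data

end Literature.NumberTheory.Transcendental.Baker1975.Ch3
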